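import Summits.QuantumFields.BalabanUV.T4Continuum.Spine.NE4.AutonomousSchemeMargin
import Mathlib.Analysis.SpecialFunctions.Trigonometric.Bounds
import Mathlib.Analysis.SpecialFunctions.Trigonometric.Deriv

/-!
# Spine/NE4/AutonomousSchemeMarginReal — (R53)(ii) THE COMPLEX BALL IS THE OPERATIVE HYPOTHESIS OF THE MARGIN RUNG: an ENTIRE one-step map with
# ARBITRARILY SMALL margin on the REAL ball (every other shape in its strongest form) and NO rate; the same map has NO margin on ANY complex ball

Cell `pub-balaban-gaps` (YM blitz G2), seat `ne4`, generation 15 (unit `pub-balaban-gaps-ne4-g15`); record `HOME/ne/NE4.md` §5 (R53)(ii).  Companion of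
`AutonomousSchemeMargin` ((R53)(i): `Markov.StrictInward` — holomorphic on a COMPLEX ball, values in a concentric ball smaller by `q < 1` — gives orbit stability by
Earle–Hamilton, hence NE4).

HONEST FRAMING.  NE4 = `T4CouplingMatching.ScaleShiftRate` is NOT IN PRINT ([Balaban1987RG1] = CMP **109** p. 264) and NOT proved; below: ONE explicit caricature (a cosine
map on `ℝ`, resp. its entire extension to `ℂ`) run through the census's hypothesis shapes; nothing of Bałaban's is asserted or instantiated; no status word moves (NE4 stays
DEPENDENT; spine 0∕9).  One finite T⁴; NOT ℝ⁴, NOT infinite volume, NOT a mass gap, NOT Clay.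

THE POINT.  (R53)(i) asks for the margin on a ball of the COMPLEXIFIED state space, whereas print complexifies fields and couplings but never the activities ((R46)'s caveat).
Is the complexification decoration — would a margin on the REAL ball, with as much real regularity as one likes, do?  NO, at any margin: the coupling-independent scheme
`cosStep c : x ↦ c·cos(πx∕(2c))` on `ℝ` (`c ≠ 0`) maps the WHOLE line into `closedBall 0 |c|` — so the real ball `ball 0 ϱ` is mapped into the concentric ball smaller by
`q = |c|∕ϱ`, as small as one pleases (§1 `mapsTo_cosStep`) —, is `π∕2`-Lipschitz and `C^∞` (indeed the restriction of an ENTIRE function, §3), the inner ball is invariant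
and contains the bare state, the read-out `id` is 1-Lipschitz, the first step is `|c|`; yet the orbit of the bare state ALTERNATES `0, c, 0, c, …` (`cos 0 = 1`,
`cos(π∕2) = 0`), so the represented β-family has scale shift `≡ |c|` and NE4 FAILS at every rate `θ < 1` (§2 `not_scaleShiftRate_cosStep`), and no orbit-stability constants
exist (`not_orbitStability_cosStep`).  And the SAME entire function `z ↦ c·cos(πz∕(2c))` on `ℂ` (§3 `cosStepC`, which represents the same β-family through the read-out
`re`) has NO margin on ANY complex ball: `¬ StrictInward (cosStepC c) ϱ q γ` for every `ϱ > 0` and every `q ∈ ]0,1[` (`not_strictInward_cosStepC` — by (R53)(i) itself: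
a margin would force NE4; directly visible on the imaginary axis, where `‖c·cos(π·iy∕(2c))‖ = |c|·cosh(πy∕(2c)) > |c|`, `norm_cosStepC_imaginary`).  So in (R53) the words
«on a ball of the COMPLEXIFIED states» carry the theorem: Earle–Hamilton's rigidity is a property of holomorphic maps of complex domains, and the real-variable statement with
the same margin — the literal TYPE of a printed inductive step «the new activities obey the old bounds with a smaller constant» read over REAL fields∕activities — gives no
rate whatsoever (compare (R48): a Lipschitz kink caps the rate at θ + δ; here even an entire map with margin → 0 has NO rate).

WHAT THIS SAYS FOR THE ROW (census (R53)(ii); classification words UNCHANGED): of the two unprinted items isolated by (R53)(i) — the margin `q < 1` and the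
complexification of the activities — NEITHER can be dropped: (i)'s §4 involution has complexification without margin, this file's cosine has margin (→ 0) without
complexification; both satisfy every other shape of the autonomous road in its strongest form and both violate NE4 at every rate.  NOT PRINTED; nothing of Bałaban's
asserted; NE4 NOT proved.
-/

noncomputable section

namespace Summit.QuantumFields.BalabanUV.T4Continuum.Spine.NE4

open Literature.MathematicalPhysics.QuantumFieldTheory.Balaban1983to89
open Literature.MathematicalPhysics.QuantumFieldTheory.Balaban1983to89.FlowStep
open Literature.MathematicalPhysics.QuantumFieldTheory.Balaban1983to89.T4CouplingMatching (ScaleShiftRate)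
open Literature.MathematicalPhysics.QuantumFieldTheory.Balaban1983to89.T4FlagMemory (extd extd_adm Adm)
open Metric Set Real

namespace Markov

/-! ## §1 The real cosine scheme: margin as small as one pleases, every other shape in its strongest form -/

section RealScheme

/-- The COUPLING-INDEPENDENT COSINE SCHEME on `ℝ`: `cosStep c g x = c·cos(πx∕(2c))` (a caricature; NOT Bałaban's RT). [folklore] -/
def cosStep (c : ℝ) : ℝ → ℝ → ℝ := fun _ x => c * Real.cos (π * x / (2 * c))

/-- [bookkeeping] The bare state `0` is sent to `c` (`cos 0 = 1`). [folklore] -/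
@[simp] theorem cosStep_zero (c g : ℝ) : cosStep c g 0 = c := by simp [cosStep]

/-- [bookkeeping] `c` is sent back to the bare state (`cos(π∕2) = 0`; `c ≠ 0`). [folklore] -/
theorem cosStep_self {c : ℝ} (hc : c ≠ 0) (g : ℝ) : cosStep c g c = 0 := by
  have h : π * c / (2 * c) = π / 2 := by field_simp
  simp [cosStep, h, Real.cos_pi_div_two]

/-- **THE WHOLE LINE IS MAPPED INTO `closedBall 0 |c|`** (`|cos| ≤ 1`). [folklore] -/
theorem abs_cosStep_le (c g x : ℝ) : |cosStep c g x| ≤ |c| := by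
  rw [cosStep, abs_mul]
  exact mul_le_of_le_one_right (abs_nonneg c) (Real.abs_cos_le_one _)

/-- **MARGIN AS SMALL AS ONE PLEASES ON THE REAL BALL**: for every radius `ϱ > 0` the step maps `ball 0 ϱ` into the concentric closed ball of radius `(|c|∕ϱ)·ϱ` — the
real-variable form of (R53)(i)'s strict inward mapping with margin `q = |c|∕ϱ`, which tends to `0` as `ϱ → ∞`. [folklore] -/
theorem mapsTo_cosStep (c g : ℝ) {ϱ : ℝ} (hϱ : 0 < ϱ) : MapsTo (cosStep c g) (ball (0 : ℝ) ϱ) (closedBall (0 : ℝ) (|c| / ϱ * ϱ)) := by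
  intro x _
  rw [mem_closedBall_zero_iff, Real.norm_eq_abs, div_mul_cancel₀ _ hϱ.ne']
  exact abs_cosStep_le c g x

/-- [bookkeeping] The inner ball `closedBall 0 |c|` is invariant (and contains the bare state). [folklore] -/
theorem invariant_cosStep (c γ : ℝ) : Invariant (cosStep c) (closedBall (0 : ℝ) |c|) γ :=
  fun g _ _ x _ => mem_closedBall_zero_iff.2 (by rw [Real.norm_eq_abs]; exact abs_cosStep_le c g x)

/-- **THE STEP IS `π∕2`-LIPSCHITZ IN THE STATE** (printed-TYPE Lipschitz control, as strong as one likes short of holomorphy on a complex ball): `|A x − A y| ≤ (π∕2)|x − y|`. [folklore] -/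
theorem dist_cosStep_le {c : ℝ} (hc : c ≠ 0) (g x y : ℝ) : dist (cosStep c g x) (cosStep c g y) ≤ π / 2 * dist x y := by
  rw [Real.dist_eq, Real.dist_eq, cosStep, cosStep, ← mul_sub, abs_mul]
  calc |c| * |Real.cos (π * x / (2 * c)) - Real.cos (π * y / (2 * c))|
      ≤ |c| * |π * x / (2 * c) - π * y / (2 * c)| := mul_le_mul_of_nonneg_left (Real.abs_cos_sub_cos_le _ _) (abs_nonneg c)
    _ = π / 2 * |x - y| := by
        rw [← abs_mul, show c * (π * x / (2 * c) - π * y / (2 * c)) = π / 2 * (x - y) by field_simp]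
        rw [abs_mul, abs_of_pos (by positivity : (0 : ℝ) < π / 2)]

/-- **THE STEP IS `C^∞` IN THE STATE** (real regularity of every order; §3: it is the restriction of an entire function). [folklore] -/
theorem contDiff_cosStep (c g : ℝ) : ContDiff ℝ ⊤ (cosStep c g) := by
  unfold cosStep
  fun_prop

/-- [bookkeeping] Coupling-independent: `StateCouplingLipschitz` with constant `0` on any set. [folklore] -/
theorem stateCouplingLipschitz_cosStep (c : ℝ) (S : Set ℝ) (γ : ℝ) : StateCouplingLipschitz (cosStep c) S 0 γ := by
  intro g g' _ _ _ _ x _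
  simp [cosStep]

/-- [bookkeeping] The first step moves the bare state by `|c|`. [folklore] -/
theorem firstStep_cosStep (c γ : ℝ) : FirstStep (cosStep c) 0 |c| γ := by
  intro g _ _
  simp

/-- [bookkeeping] The identity read-out is 1-Lipschitz on every set. [folklore] -/
theorem readLipschitzOn_id (S : Set ℝ) : ReadLipschitzOn (fun x : ℝ => x) S 1 :=
  fun x _ x' _ => by rw [one_mul, Real.dist_eq]

end RealScheme

/-! ## §2 The orbit of the bare state alternates: NE4 fails at every rate, no orbit stability -/

section NoRate

/-- **THE ORBIT OF THE BARE STATE ALTERNATES** `0, c, 0, c, …` along every coupling sequence (`c ≠ 0`). [folklore] -/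
theorem state_cosStep {c : ℝ} (hc : c ≠ 0) (g : ℕ → ℝ) : ∀ j, state (cosStep c) 0 g j = if Even j then 0 else c
  | 0 => by simp
  | j + 1 => by
    rw [state_succ, state_cosStep hc g j]
    by_cases hj : Even j
    · simp [hj, Nat.even_add_one]
    · simp [hj, Nat.even_add_one, cosStep_self hc]

/-- The β-family READ OFF the cosine scheme by the identity (so the representation hypothesis holds by definition). [folklore] -/
def cosBeta (c : ℝ) : HBeta := fun k v => state (cosStep c) 0 (extd v) (k + 1)

/-- [bookkeeping] `RepresentsAut (cosStep c) id 0 γ (cosBeta c)` — by definition. [folklore] -/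
theorem representsAut_cosBeta (c γ : ℝ) : RepresentsAut (cosStep c) (fun x : ℝ => x) 0 γ (cosBeta c) := fun _ _ _ => rfl

/-- [bookkeeping] The represented family alternates: `cosBeta c k v = c` for even `k`, `0` for odd `k`. [folklore] -/
theorem cosBeta_eq {c : ℝ} (hc : c ≠ 0) (k : ℕ) (v : Fin (k + 1) → ℝ) : cosBeta c k v = if Even k then c else 0 := by
  rw [cosBeta, state_cosStep hc]
  by_cases hk : Even k
  · simp [hk, Nat.even_add_one]
  · simp [hk, Nat.even_add_one]

/-- **THE SCALE SHIFT IS CONSTANT**: `|β (k+1) w − β k (tail w)| = |c|` for every `k` and every history. [folklore] -/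
theorem cosBeta_shift {c : ℝ} (hc : c ≠ 0) (k : ℕ) (w : Fin (k + 2) → ℝ) : |cosBeta c (k + 1) w - cosBeta c k (Fin.tail w)| = |c| := by
  rw [cosBeta_eq hc, cosBeta_eq hc]
  by_cases hk : Even k
  · simp [hk, Nat.even_add_one]
  · simp [hk, Nat.even_add_one]

/-- **MARGIN WITHOUT COMPLEXIFICATION GIVES NO RATE: NE4 FAILS FOR THE COSINE FAMILY AT EVERY RATE `θ < 1`** (`c ≠ 0`, `γ > 0`; all `c′`). [folklore] -/
theorem not_scaleShiftRate_cosStep {c γ θ : ℝ} (hc : c ≠ 0) (hγ : 0 < γ) (hθ1 : θ < 1) (c' : ℝ) :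
    ¬ ScaleShiftRate c' θ γ (cosBeta c) := by
  intro hS
  have hcpos : 0 < |c| := abs_pos.2 hc
  have hbox : ∀ k, (fun _ : Fin (k + 2) => γ) ∈ Box γ (k + 1) := fun k => mem_box.2 fun _ => ⟨hγ, le_rfl⟩
  have hle : ∀ k, |c| ≤ c' * θ ^ k := fun k => by
    have h := hS k (fun _ => γ) (hbox k)
    rwa [cosBeta_shift hc] at h
  have hc' : 0 < c' := by
    have h0 := hle 0
    rw [pow_zero, mul_one] at h0
    linarith
  obtain ⟨k, hk⟩ := exists_pow_lt_of_lt_one (div_pos hcpos hc') hθ1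
  have h1 := hle k
  have h2 : c' * θ ^ k < c' * (|c| / c') := mul_lt_mul_of_pos_left hk hc'
  rw [mul_div_cancel₀ _ hc'.ne'] at h2
  linarith

/-- **NO ORBIT STABILITY ON THE INVARIANT INNER BALL** (`C ≥ 0`, `0 ≤ θ < 1`, `c ≠ 0`, `γ > 0`): else (R42)'s `scaleShiftRate_of_stable` would give NE4. [folklore] -/
theorem not_orbitStability_cosStep {c γ θ C : ℝ} (hc : c ≠ 0) (hγ : 0 < γ) (hC : 0 ≤ C) (hθ0 : 0 ≤ θ) (hθ1 : θ < 1) :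
    ¬ OrbitStability (cosStep c) (closedBall (0 : ℝ) |c|) C θ γ := fun hst =>
  not_scaleShiftRate_cosStep hc hγ hθ1 (1 * C * |c| * θ)
    (scaleShiftRate_of_stable (invariant_cosStep c γ) (mem_closedBall_self (abs_nonneg c)) hst (firstStep_cosStep c γ) hC hθ0
      zero_le_one (representsAut_cosBeta c γ) (readLipschitzOn_id _))

end NoRate

/-! ## §3 The same map, complexified: entire, represents the same family, and has NO margin on ANY complex ball -/

section Complexified

/-- The ENTIRE EXTENSION of the cosine scheme: `cosStepC c g z = c·cos(πz∕(2c))` on `ℂ`. [folklore] -/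
def cosStepC (c : ℝ) : ℝ → ℂ → ℂ := fun _ z => (c : ℂ) * Complex.cos ((π : ℂ) * z / (2 * (c : ℂ)))

/-- [bookkeeping] The complex scheme is ENTIRE (complex-differentiable everywhere) — in particular holomorphic on every ball. [folklore] -/
theorem differentiable_cosStepC (c g : ℝ) : Differentiable ℂ (cosStepC c g) := by
  unfold cosStepC
  fun_prop

/-- [bookkeeping] On the real axis the complex scheme IS the real scheme. [folklore] -/
theorem cosStepC_ofReal (c g x : ℝ) : cosStepC c g (x : ℂ) = ((cosStep c g x : ℝ) : ℂ) := by
  simp only [cosStepC, cosStep, Complex.ofReal_mul, Complex.ofReal_cos, Complex.ofReal_div, Complex.ofReal_ofNat]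

/-- [bookkeeping] Along every coupling sequence the complex orbit of the bare state is the real one. [folklore] -/
theorem state_cosStepC (c : ℝ) (g : ℕ → ℝ) : ∀ j, state (cosStepC c) 0 g j = ((state (cosStep c) 0 g j : ℝ) : ℂ)
  | 0 => by simp
  | j + 1 => by rw [state_succ, state_succ, state_cosStepC c g j, cosStepC_ofReal]

/-- [bookkeeping] The complex scheme with the read-out `re` REPRESENTS THE SAME β-family `cosBeta c`. [folklore] -/
theorem representsAut_cosBetaC (c γ : ℝ) : RepresentsAut (cosStepC c) Complex.re 0 γ (cosBeta c) := by
  intro k v _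
  rw [state_cosStepC, Complex.ofReal_re]
  rfl

/-- **OFF THE REAL AXIS THE MARGIN `|c|` IS ALREADY VIOLATED**: `‖c·cos(π(y·i)∕(2c))‖ = |c|·cosh(πy∕(2c)) > |c|` for real `y ≠ 0` (`c ≠ 0`). [folklore] -/
theorem norm_cosStepC_imaginary {c : ℝ} (hc : c ≠ 0) (g : ℝ) {y : ℝ} (hy : y ≠ 0) : |c| < ‖cosStepC c g ((y : ℂ) * Complex.I)‖ := by
  have harg : (π : ℂ) * ((y : ℂ) * Complex.I) / (2 * (c : ℂ)) = ((π * y / (2 * c) : ℝ) : ℂ) * Complex.I := by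
    push_cast
    field_simp
  rw [cosStepC, harg, Complex.cos_mul_I, ← Complex.ofReal_cosh, norm_mul, Complex.norm_real, Complex.norm_real, Real.norm_eq_abs,
    Real.norm_eq_abs, abs_of_pos (Real.cosh_pos _)]
  have h1 : 1 < Real.cosh (π * y / (2 * c)) := Real.one_lt_cosh.2 (by positivity)
  have hcpos : 0 < |c| := abs_pos.2 hc
  nlinarith

/-- **NO MARGIN ON ANY COMPLEX BALL** (an application of (R53)(i) as an OBSTRUCTION): for every radius `ϱ > 0`, every margin `q ∈ ]0,1[` and every box `γ > 0`,
`¬ StrictInward (cosStepC c) ϱ q γ` (`c ≠ 0`) — otherwise `scaleShiftRate_of_strictInward` (Earle–Hamilton) with the 1-Lipschitz read-out `re` would give NE4 for the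
represented family `cosBeta c`, contradicting `not_scaleShiftRate_cosStep`.  The complexification is where the cosine scheme fails (R53)(i), not the margin. [folklore] -/
theorem not_strictInward_cosStepC {c ϱ q γ : ℝ} (hc : c ≠ 0) (hϱ : 0 < ϱ) (hq0 : 0 < q) (hq1 : q < 1) (hγ : 0 < γ) :
    ¬ StrictInward (cosStepC c) ϱ q γ := fun h =>
  not_scaleShiftRate_cosStep hc hγ (lt_ehRate_lt_one hq0 hq1).2 _
    (scaleShiftRate_of_strictInward hϱ hq0 hq1 zero_le_one h (representsAut_cosBetaC c γ) (readLipschitzOn_re _))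

end Complexified

end Markov

end Summit.QuantumFields.BalabanUV.T4Continuum.Spine.NE4

end
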